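import Mathlib
import Summits.Ventures.PercRepro2.MixChordORootEdgeClosureMirror

/-!
# The root-edge closure of the `o`-class `D`-chord modulo `(S)` — degenerate masses included
(blind cell PercRepro2, night-1 g22; proofs/NIGHT1-G22.md §6)

MixChordORootEdgeClosure.lean / MixChordORootEdgeClosureMirror.lean assume `0 < M = Q₀Q₁Q₀⁰Q₁⁰`.  When
`M = 0` the chord is forced: `Q₀ = 0` kills `D(p)` and `Gc(p)` (`PD ⊆ Q`, `Gc_eq_zero_of_D_Do`), `Q₀⁰ = 0`
forces `Q₀ = 0` (`Q` does not increase when the `o`-edge opens), and `Q₁ = 0` kills `D₀ ≤ Q₁` (`PD ⊆ Q ∩ {a₃ ∉ C₂}`,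
`prob_one_Q`) while `Gc(p) = (1 − t)³·Gc(p₀)` (p5's `Gc_eq_of_Q_one_zero`), so the chord at `p` is the
chord at `p₀` times a nonnegative factor; `Q₁⁰ = 0` forces `Q₁ = 0`.  Hence the unconditional
**`dChord_of_update_zero`** (`e = {a₁, a₃}`) and **`dChord_of_update_zero'`** (`e = {a₂, a₃}`):
`0 ≤ S → (D-chord at p[e ↦ 0]) → (D-chord at p)`.

CENSUS CORRECTION (kit j284375, n ≤ 8, 2,405 instances): `(S) ≥ 0` FAILS on 9 instances (all with
`S/(Q₀Q₁Q₁⁰²·Δ₀) ∈ [−0.022, 0)`), while the middle Bernstein coefficient `2β₁ = Q₀Q₁Q₁⁰²·Δ₀ + S`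
stayed nonnegative on every instance seen (2,645).  The sharp form of the closure therefore takes
`0 ≤ Q₀Q₁Q₁⁰²·Δ₀ + S` — the closed child's deficit `Δ₀` used quantitatively — as its hypothesis:
**`dChord_of_update_zero_of_beta1`** (and its mirror **`dChord_of_update_zero_of_beta1'`**).
Own code; standard axioms.
-/

namespace Summit.Ventures.PercRepro2

open UnionCluster CovForm

namespace Mix

section Degenerate

variable {V : Type*} {E : Type*} [Fintype E] [DecidableEq E] [Fintype V] [DecidableEq V]
  {R : Type*} [Field R] [LinearOrder R] [IsStrictOrderedRing R]

variable (p : E → R) (ends : E → Sym2 V) {o a₁ a₂ a₃ : V} (b : V) {e f : E}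

omit [Fintype E] [DecidableEq E] [Fintype V] [DecidableEq V] in
/-- `PD ⊆ Q ∩ {a₃ ∉ C₂}`. -/
lemma PDEvent_subset_Q_inter (a₁ a₂ a₃ : V) :
    PDEvent ends a₁ a₂ a₃ ⊆ avoidAll ends a₂ {a₁} ∩ (connEvent ends a₂ a₃)ᶜ := by
  intro ω hω
  refine ⟨Chord.PDEvent_subset_avoidAll ends a₁ a₂ a₃ hω, fun h => ?_⟩
  exact hω.2 (Or.inr (conn_symm h))

omit [Fintype V] [DecidableEq V] in
/-- `D_o ≤ D`... in the form needed: `D = 0 → D_o = 0`. -/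
lemma Do_eq_zero_of_PD (hp : IsProbVec p) (o a₁ a₂ a₃ : V) (hD : prob p (PDEvent ends a₁ a₂ a₃) = 0) :
    Do p ends o a₁ a₂ a₃ = 0 := by
  unfold Do
  have h1 := prob_inter_le_left hp (PDEvent ends a₁ a₂ a₃) (connEvent ends a₁ o)
  have h2 := prob_inter_le_left hp (PDEvent ends a₁ a₂ a₃) (connEvent ends a₂ o)
  have n1 := prob_nonneg hp (PDEvent ends a₁ a₂ a₃ ∩ connEvent ends a₁ o)
  have n2 := prob_nonneg hp (PDEvent ends a₁ a₂ a₃ ∩ connEvent ends a₂ o)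
  linarith

omit [Fintype V] [DecidableEq V] in
/-- **The degenerate cases of the root-edge closure** (`e = {a₁, a₃}`, any `o`-edge `f` with `Gc(p[f ↦ 1]) = 0`
at `p` and at `p[e ↦ 0]`): when `Q₀Q₁Q₀⁰Q₁⁰ = 0` the chord at `p` follows from the chord at `p[e ↦ 0]`. -/
lemma dChord_of_update_zero_of_degenerate (hp : IsProbVec p) (hends : ends e = s(a₁, a₃)) (hef : e ≠ f)
    (hG1 : Gc (Function.update p f 1) ends o a₁ a₂ a₃ b = 0)
    (hG1' : Gc (Function.update (Function.update p e 0) f 1) ends o a₁ a₂ a₃ b = 0)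
    (hM : prob (Function.update p e 0) (avoidAll ends a₂ {a₁}) *
      prob (Function.update p e 1) (avoidAll ends a₂ {a₁}) *
      prob (Function.update (Function.update p f 0) e 0) (avoidAll ends a₂ {a₁}) *
      prob (Function.update (Function.update p f 0) e 1) (avoidAll ends a₂ {a₁}) = 0)
    (h0 : NMixChord (normD ends a₁ a₂ a₃) (Function.update p e 0) ends o a₁ a₂ a₃ b f) :
    NMixChord (normD ends a₁ a₂ a₃) p ends o a₁ a₂ a₃ b f := by
  have hp0 : IsProbVec (Function.update p e 0) := hp.update e le_rfl zero_le_one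
  have hp1 : IsProbVec (Function.update p e 1) := hp.update e zero_le_one le_rfl
  have hpf : IsProbVec (Function.update p f 0) := hp.update f le_rfl zero_le_one
  have hq0 := hp.nonneg f
  have hq1 := hp.le_one f
  have ht0 := hp.nonneg e
  have ht1 := hp.le_one e
  unfold NMixChord normD at h0 ⊢
  rw [hG1', mul_zero, sub_zero, Function.update_of_ne hef.symm, Function.update_comm hef] at h0
  rw [hG1, mul_zero, sub_zero]
  -- `D(p) = (1 − t) D₀`, `D(p⁰) = (1 − t) D₀⁰`
  have hD := prob_PD_eq_update_zero p ends (a₂ := a₂) hends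
  have hDf := prob_PD_eq_update_zero (Function.update p f 0) ends (a₂ := a₂) hends
  rw [Function.update_of_ne hef] at hDf
  -- `Q` does not increase when the `o`-edge opens (at `p[e ↦ 0]` and at `p[e ↦ 1]`)
  have hQ0le : prob (Function.update p e 0) (avoidAll ends a₂ {a₁}) ≤
      prob (Function.update (Function.update p f 0) e 0) (avoidAll ends a₂ {a₁}) := by
    have := EdmRow.prob_le_prob_update_zero_of_isLowerSet hp0 (EdmRow.isLowerSet_avoidAll ends a₁ a₂) f
    rwa [Function.update_comm hef] at this
  have hQ1le : prob (Function.update p e 1) (avoidAll ends a₂ {a₁}) ≤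
      prob (Function.update (Function.update p f 0) e 1) (avoidAll ends a₂ {a₁}) := by
    have := EdmRow.prob_le_prob_update_zero_of_isLowerSet hp1 (EdmRow.isLowerSet_avoidAll ends a₁ a₂) f
    rwa [Function.update_comm hef] at this
  have hQ0n := prob_nonneg hp0 (avoidAll ends a₂ {a₁})
  have hQ1n := prob_nonneg hp1 (avoidAll ends a₂ {a₁})
  -- `D₀ ≤ Q₀` and `D₀ ≤ Q₁`
  have hD0leQ0 : prob (Function.update p e 0) (PDEvent ends a₁ a₂ a₃) ≤
      prob (Function.update p e 0) (avoidAll ends a₂ {a₁}) :=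
    prob_mono hp0 (Chord.PDEvent_subset_avoidAll ends a₁ a₂ a₃)
  have hD0leQ1 : prob (Function.update p e 0) (PDEvent ends a₁ a₂ a₃) ≤
      prob (Function.update p e 1) (avoidAll ends a₂ {a₁}) := by
    rw [RootEdge.prob_one_Q p hends a₂]
    exact prob_mono hp0 (PDEvent_subset_Q_inter ends a₁ a₂ a₃)
  have hD0n := prob_nonneg hp0 (PDEvent ends a₁ a₂ a₃)
  have hD0fn := prob_nonneg (hpf.update e le_rfl zero_le_one) (PDEvent ends a₁ a₂ a₃)
  -- the case split: some factor of `M` vanishes; either way `D₀ = 0`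
  have hD0 : prob (Function.update p e 0) (PDEvent ends a₁ a₂ a₃) = 0 := by
    rcases mul_eq_zero.1 hM with h | h
    · rcases mul_eq_zero.1 h with h | h
      · rcases mul_eq_zero.1 h with h | h
        · exact le_antisymm (hD0leQ0.trans h.le) hD0n
        · exact le_antisymm (hD0leQ1.trans h.le) hD0n
      · exact le_antisymm (hD0leQ0.trans (hQ0le.trans h.le)) hD0n
    · exact le_antisymm (hD0leQ1.trans (hQ1le.trans h.le)) hD0n
  -- with `D₀ = 0`: `D(p) = 0`, and either `Q₀ = 0` (then `Gc(p) = 0`) or `Q₁ = 0` (then `Gc(p) = (1 − t)³ Gc(p₀)`)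
  rw [hD, hDf, hD0]
  rw [hD0] at h0
  simp only [mul_zero] at h0 ⊢
  -- `0 ≤ Gc(p) · ((1 − t) D₀⁰)`
  by_cases hQ1 : prob (Function.update p e 1) (avoidAll ends a₂ {a₁}) = 0
  · rw [RootEdge.Gc_eq_of_Q_one_zero p hp ends o a₁ a₂ a₃ b e hends hQ1]
    have h1t : 0 ≤ 1 - p e := sub_nonneg.2 ht1
    have : 0 ≤ Gc (Function.update p e 0) ends o a₁ a₂ a₃ b *
        prob (Function.update (Function.update p f 0) e 0) (PDEvent ends a₁ a₂ a₃) := h0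
    linear_combination mul_nonneg (pow_nonneg h1t 4) this
  · -- then `Q₀ = 0` (otherwise `D₀ = 0` came from `Q₁ = 0`): `D(p) = 0 = D_o(p)` and `Gc(p) = 0`
    have hDp : prob p (PDEvent ends a₁ a₂ a₃) = 0 := by rw [hD, hD0, mul_zero]
    rw [RootEdge.Gc_eq_zero_of_D_Do p ends o a₁ a₂ a₃ b hDp (Do_eq_zero_of_PD p ends hp o a₁ a₂ a₃ hDp)]
    simp

omit [Fintype V] [DecidableEq V] in
/-- **THE ROOT-EDGE CLOSURE OF THE `o`-CLASS `D`-CHORD MODULO `(S)`, unconditional**: for `e = {a₁, a₃}` and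
`f = {o, a₁}`, `0 ≤ S` and the `D`-chord at `p[e ↦ 0]` give the `D`-chord at `p`. -/
theorem dChord_of_update_zero (hp : IsProbVec p) (hends : ends e = s(a₁, a₃))
    (hf : ends f = s(o, a₁)) (hef : e ≠ f) (hS : 0 ≤ SClosure p ends o a₁ a₂ a₃ b e f)
    (h0 : NMixChord (normD ends a₁ a₂ a₃) (Function.update p e 0) ends o a₁ a₂ a₃ b f) :
    NMixChord (normD ends a₁ a₂ a₃) p ends o a₁ a₂ a₃ b f := by
  have hp0 : IsProbVec (Function.update p e 0) := hp.update e le_rfl zero_le_one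
  have hpf : IsProbVec (Function.update p f 0) := hp.update f le_rfl zero_le_one
  have hMn : 0 ≤ prob (Function.update p e 0) (avoidAll ends a₂ {a₁}) *
      prob (Function.update p e 1) (avoidAll ends a₂ {a₁}) *
      prob (Function.update (Function.update p f 0) e 0) (avoidAll ends a₂ {a₁}) *
      prob (Function.update (Function.update p f 0) e 1) (avoidAll ends a₂ {a₁}) :=
    mul_nonneg (mul_nonneg (mul_nonneg (prob_nonneg hp0 _) (prob_nonneg (hp.update e zero_le_one le_rfl) _))
      (prob_nonneg (hpf.update e le_rfl zero_le_one) _)) (prob_nonneg (hpf.update e zero_le_one le_rfl) _)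
  rcases hMn.lt_or_eq with hM | hM
  · exact dChord_of_update_zero_of_S p ends b hp hends hf hef hM hS h0
  · exact dChord_of_update_zero_of_degenerate p ends b hp hends hef
      (Gc_eq_zero_of_sure_conn_o _ ends o a₃ b (conn_a1_o_of_update_one p ends hf))
      (Gc_eq_zero_of_sure_conn_o _ ends o a₃ b (conn_a1_o_of_update_one (Function.update p e 0) ends hf))
      hM.symm h0

/-- **The same at the other root** (`e = {a₂, a₃}`, `f = {o, a₁}`), modulo the root-swapped `(S)`. -/
theorem dChord_of_update_zero' (hp : IsProbVec p) (hends : ends e = s(a₂, a₃))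
    (hf : ends f = s(o, a₁)) (hef : e ≠ f) (hS : 0 ≤ SClosure p ends o a₂ a₁ a₃ b e f)
    (h0 : NMixChord (normD ends a₁ a₂ a₃) (Function.update p e 0) ends o a₁ a₂ a₃ b f) :
    NMixChord (normD ends a₁ a₂ a₃) p ends o a₁ a₂ a₃ b f := by
  have hp0 : IsProbVec (Function.update p e 0) := hp.update e le_rfl zero_le_one
  have hpf : IsProbVec (Function.update p f 0) := hp.update f le_rfl zero_le_one
  have hMn : 0 ≤ prob (Function.update p e 0) (avoidAll ends a₂ {a₁}) *
      prob (Function.update p e 1) (avoidAll ends a₂ {a₁}) *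
      prob (Function.update (Function.update p f 0) e 0) (avoidAll ends a₂ {a₁}) *
      prob (Function.update (Function.update p f 0) e 1) (avoidAll ends a₂ {a₁}) :=
    mul_nonneg (mul_nonneg (mul_nonneg (prob_nonneg hp0 _) (prob_nonneg (hp.update e zero_le_one le_rfl) _))
      (prob_nonneg (hpf.update e le_rfl zero_le_one) _)) (prob_nonneg (hpf.update e zero_le_one le_rfl) _)
  rcases hMn.lt_or_eq with hM | hM
  · exact dChord_of_update_zero_of_S' p ends b hp hends hf hef hM hS h0
  · rw [← nMixChord_normD_root_swap] at h0 ⊢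
    rw [avoidAll_root_swap] at hM
    refine dChord_of_update_zero_of_degenerate p ends b hp hends hef ?_ ?_ hM.symm h0
    · rw [Gc_swap]
      exact Gc_eq_zero_of_sure_conn_o _ ends o a₃ b (conn_a1_o_of_update_one p ends hf)
    · rw [Gc_swap]
      exact Gc_eq_zero_of_sure_conn_o _ ends o a₃ b (conn_a1_o_of_update_one (Function.update p e 0) ends hf)

omit [Fintype V] [DecidableEq V] in
/-- **The sharp root-edge closure** (`e = {a₁, a₃}`, `f = {o, a₁}`): the middle Bernstein coefficient
`0 ≤ Q₀Q₁Q₁⁰²·Δ₀ + S` (instead of `0 ≤ S`) and the `D`-chord at `p[e ↦ 0]` give the `D`-chord at `p`. -/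
theorem dChord_of_update_zero_of_beta1 (hp : IsProbVec p) (hends : ends e = s(a₁, a₃))
    (hf : ends f = s(o, a₁)) (hef : e ≠ f)
    (hβ : 0 ≤ prob (Function.update p e 0) (avoidAll ends a₂ {a₁}) *
        prob (Function.update p e 1) (avoidAll ends a₂ {a₁}) *
        prob (Function.update (Function.update p f 0) e 1) (avoidAll ends a₂ {a₁}) ^ 2 *
        (Gc (Function.update p e 0) ends o a₁ a₂ a₃ b *
            prob (Function.update (Function.update p f 0) e 0) (PDEvent ends a₁ a₂ a₃) -
          (1 - p f) * Gc (Function.update (Function.update p f 0) e 0) ends o a₁ a₂ a₃ b *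
            prob (Function.update p e 0) (PDEvent ends a₁ a₂ a₃)) +
      SClosure p ends o a₁ a₂ a₃ b e f)
    (h0 : NMixChord (normD ends a₁ a₂ a₃) (Function.update p e 0) ends o a₁ a₂ a₃ b f) :
    NMixChord (normD ends a₁ a₂ a₃) p ends o a₁ a₂ a₃ b f := by
  have hp0 : IsProbVec (Function.update p e 0) := hp.update e le_rfl zero_le_one
  have hpf : IsProbVec (Function.update p f 0) := hp.update f le_rfl zero_le_one
  have hp0f : IsProbVec (Function.update (Function.update p f 0) e 0) := hpf.update e le_rfl zero_le_one
  have hMn : 0 ≤ prob (Function.update p e 0) (avoidAll ends a₂ {a₁}) *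
      prob (Function.update p e 1) (avoidAll ends a₂ {a₁}) *
      prob (Function.update (Function.update p f 0) e 0) (avoidAll ends a₂ {a₁}) *
      prob (Function.update (Function.update p f 0) e 1) (avoidAll ends a₂ {a₁}) :=
    mul_nonneg (mul_nonneg (mul_nonneg (prob_nonneg hp0 _) (prob_nonneg (hp.update e zero_le_one le_rfl) _))
      (prob_nonneg (hpf.update e le_rfl zero_le_one) _)) (prob_nonneg (hpf.update e zero_le_one le_rfl) _)
  rcases hMn.lt_or_eq with hM | hM
  · have hG1 : Gc (Function.update p f 1) ends o a₁ a₂ a₃ b = 0 :=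
      Gc_eq_zero_of_sure_conn_o _ ends o a₃ b (conn_a1_o_of_update_one p ends hf)
    have hG1' : Gc (Function.update (Function.update p e 0) f 1) ends o a₁ a₂ a₃ b = 0 :=
      Gc_eq_zero_of_sure_conn_o _ ends o a₃ b (conn_a1_o_of_update_one (Function.update p e 0) ends hf)
    unfold NMixChord normD at h0 ⊢
    rw [hG1', mul_zero, sub_zero, Function.update_of_ne hef.symm, Function.update_comm hef] at h0
    rw [hG1, mul_zero, sub_zero]
    have hΔ₀ : 0 ≤ Gc (Function.update p e 0) ends o a₁ a₂ a₃ b *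
        prob (Function.update (Function.update p f 0) e 0) (PDEvent ends a₁ a₂ a₃) -
        (1 - p f) * Gc (Function.update (Function.update p f 0) e 0) ends o a₁ a₂ a₃ b *
          prob (Function.update p e 0) (PDEvent ends a₁ a₂ a₃) := by linarith
    have hg := g1_chord p ends (a₂ := a₂) b hp hf hef
    have ht0 := hp.nonneg e
    have ht1 := hp.le_one e
    have h1t : 0 ≤ 1 - p e := sub_nonneg.2 ht1
    have hD0 := prob_nonneg hp0 (PDEvent ends a₁ a₂ a₃)
    have hD0f := prob_nonneg hp0f (PDEvent ends a₁ a₂ a₃)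
    have hid := closure_identity p ends b (o := o) (a₂ := a₂) hends hef
    have hbr : 0 ≤ (1 - p e) ^ 2 *
        ((1 - p e) ^ 2 *
            (prob (Function.update p e 0) (avoidAll ends a₂ {a₁}) * prob (Function.update p e 1) (avoidAll ends a₂ {a₁}) *
              prob (Function.update (Function.update p f 0) e 0) (avoidAll ends a₂ {a₁}) *
              prob (Function.update (Function.update p f 0) e 1) (avoidAll ends a₂ {a₁})) *
            (Gc (Function.update p e 0) ends o a₁ a₂ a₃ b *
                prob (Function.update (Function.update p f 0) e 0) (PDEvent ends a₁ a₂ a₃) -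
              (1 - p f) * Gc (Function.update (Function.update p f 0) e 0) ends o a₁ a₂ a₃ b *
                prob (Function.update p e 0) (PDEvent ends a₁ a₂ a₃)) +
          p e * (1 - p e) *
            (prob (Function.update p e 0) (avoidAll ends a₂ {a₁}) * prob (Function.update p e 1) (avoidAll ends a₂ {a₁}) *
                prob (Function.update (Function.update p f 0) e 1) (avoidAll ends a₂ {a₁}) ^ 2 *
                (Gc (Function.update p e 0) ends o a₁ a₂ a₃ b *
                    prob (Function.update (Function.update p f 0) e 0) (PDEvent ends a₁ a₂ a₃) -
                  (1 - p f) * Gc (Function.update (Function.update p f 0) e 0) ends o a₁ a₂ a₃ b *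
                    prob (Function.update p e 0) (PDEvent ends a₁ a₂ a₃)) +
              SClosure p ends o a₁ a₂ a₃ b e f) +
          p e ^ 2 *
            (prob (Function.update p e 0) (avoidAll ends a₂ {a₁}) * prob (Function.update p e 1) (avoidAll ends a₂ {a₁}) *
              prob (Function.update (Function.update p f 0) e 0) (avoidAll ends a₂ {a₁}) *
              prob (Function.update (Function.update p f 0) e 1) (avoidAll ends a₂ {a₁})) *
            (prob (Function.update p e 0) (PDEvent ends a₁ a₂ a₃) *
              prob (Function.update (Function.update p f 0) e 0) (PDEvent ends a₁ a₂ a₃)) *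
            (g1C p ends o a₁ a₂ b e - (1 - p f) * g1C (Function.update p f 0) ends o a₁ a₂ b e)) := by
      have hM' := hM.le
      refine mul_nonneg (sq_nonneg _) (add_nonneg (add_nonneg ?_ ?_) ?_)
      · exact mul_nonneg (mul_nonneg (sq_nonneg _) hM') hΔ₀
      · exact mul_nonneg (mul_nonneg ht0 h1t) hβ
      · exact mul_nonneg (mul_nonneg (mul_nonneg (sq_nonneg _) hM') (mul_nonneg hD0 hD0f))
          (sub_nonneg.2 hg)
    rw [← hid] at hbr
    have hX := (mul_nonneg_iff_of_pos_left hM).1 hbr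
    linarith
  · exact dChord_of_update_zero_of_degenerate p ends b hp hends hef
      (Gc_eq_zero_of_sure_conn_o _ ends o a₃ b (conn_a1_o_of_update_one p ends hf))
      (Gc_eq_zero_of_sure_conn_o _ ends o a₃ b (conn_a1_o_of_update_one (Function.update p e 0) ends hf))
      hM.symm h0

/-- **The sharp root-edge closure at the other root** (`e = {a₂, a₃}`, `f = {o, a₁}`), with the root-swapped
middle coefficient as hypothesis. -/
theorem dChord_of_update_zero_of_beta1' (hp : IsProbVec p) (hends : ends e = s(a₂, a₃))
    (hf : ends f = s(o, a₁)) (hef : e ≠ f)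
    (hβ : 0 ≤ prob (Function.update p e 0) (avoidAll ends a₁ {a₂}) *
        prob (Function.update p e 1) (avoidAll ends a₁ {a₂}) *
        prob (Function.update (Function.update p f 0) e 1) (avoidAll ends a₁ {a₂}) ^ 2 *
        (Gc (Function.update p e 0) ends o a₂ a₁ a₃ b *
            prob (Function.update (Function.update p f 0) e 0) (PDEvent ends a₂ a₁ a₃) -
          (1 - p f) * Gc (Function.update (Function.update p f 0) e 0) ends o a₂ a₁ a₃ b *
            prob (Function.update p e 0) (PDEvent ends a₂ a₁ a₃)) +
      SClosure p ends o a₂ a₁ a₃ b e f)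
    (h0 : NMixChord (normD ends a₁ a₂ a₃) (Function.update p e 0) ends o a₁ a₂ a₃ b f) :
    NMixChord (normD ends a₁ a₂ a₃) p ends o a₁ a₂ a₃ b f := by
  have hp0 : IsProbVec (Function.update p e 0) := hp.update e le_rfl zero_le_one
  have hpf : IsProbVec (Function.update p f 0) := hp.update f le_rfl zero_le_one
  have hp0f : IsProbVec (Function.update (Function.update p f 0) e 0) := hpf.update e le_rfl zero_le_one
  have hG1 : Gc (Function.update p f 1) ends o a₂ a₁ a₃ b = 0 := by
    rw [Gc_swap]
    exact Gc_eq_zero_of_sure_conn_o _ ends o a₃ b (conn_a1_o_of_update_one p ends hf)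
  have hG1' : Gc (Function.update (Function.update p e 0) f 1) ends o a₂ a₁ a₃ b = 0 := by
    rw [Gc_swap]
    exact Gc_eq_zero_of_sure_conn_o _ ends o a₃ b (conn_a1_o_of_update_one (Function.update p e 0) ends hf)
  rw [← nMixChord_normD_root_swap] at h0 ⊢
  have hMn : 0 ≤ prob (Function.update p e 0) (avoidAll ends a₁ {a₂}) *
      prob (Function.update p e 1) (avoidAll ends a₁ {a₂}) *
      prob (Function.update (Function.update p f 0) e 0) (avoidAll ends a₁ {a₂}) *
      prob (Function.update (Function.update p f 0) e 1) (avoidAll ends a₁ {a₂}) :=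
    mul_nonneg (mul_nonneg (mul_nonneg (prob_nonneg hp0 _) (prob_nonneg (hp.update e zero_le_one le_rfl) _))
      (prob_nonneg (hpf.update e le_rfl zero_le_one) _)) (prob_nonneg (hpf.update e zero_le_one le_rfl) _)
  rcases hMn.lt_or_eq with hM | hM
  · unfold NMixChord normD at h0 ⊢
    rw [hG1', mul_zero, sub_zero, Function.update_of_ne hef.symm, Function.update_comm hef] at h0
    rw [hG1, mul_zero, sub_zero]
    have hΔ₀ : 0 ≤ Gc (Function.update p e 0) ends o a₂ a₁ a₃ b *
        prob (Function.update (Function.update p f 0) e 0) (PDEvent ends a₂ a₁ a₃) -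
        (1 - p f) * Gc (Function.update (Function.update p f 0) e 0) ends o a₂ a₁ a₃ b *
          prob (Function.update p e 0) (PDEvent ends a₂ a₁ a₃) := by linarith
    have hg := g1_chord' p ends (a₂ := a₂) b hp hf hef
    have ht0 := hp.nonneg e
    have ht1 := hp.le_one e
    have h1t : 0 ≤ 1 - p e := sub_nonneg.2 ht1
    have hD0 := prob_nonneg hp0 (PDEvent ends a₂ a₁ a₃)
    have hD0f := prob_nonneg hp0f (PDEvent ends a₂ a₁ a₃)
    have hid := closure_identity p ends b (o := o) (a₁ := a₂) (a₂ := a₁) (a₃ := a₃) hends hef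
    have hbr : 0 ≤ (1 - p e) ^ 2 *
        ((1 - p e) ^ 2 *
            (prob (Function.update p e 0) (avoidAll ends a₁ {a₂}) * prob (Function.update p e 1) (avoidAll ends a₁ {a₂}) *
              prob (Function.update (Function.update p f 0) e 0) (avoidAll ends a₁ {a₂}) *
              prob (Function.update (Function.update p f 0) e 1) (avoidAll ends a₁ {a₂})) *
            (Gc (Function.update p e 0) ends o a₂ a₁ a₃ b *
                prob (Function.update (Function.update p f 0) e 0) (PDEvent ends a₂ a₁ a₃) -
              (1 - p f) * Gc (Function.update (Function.update p f 0) e 0) ends o a₂ a₁ a₃ b *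
                prob (Function.update p e 0) (PDEvent ends a₂ a₁ a₃)) +
          p e * (1 - p e) *
            (prob (Function.update p e 0) (avoidAll ends a₁ {a₂}) * prob (Function.update p e 1) (avoidAll ends a₁ {a₂}) *
                prob (Function.update (Function.update p f 0) e 1) (avoidAll ends a₁ {a₂}) ^ 2 *
                (Gc (Function.update p e 0) ends o a₂ a₁ a₃ b *
                    prob (Function.update (Function.update p f 0) e 0) (PDEvent ends a₂ a₁ a₃) -
                  (1 - p f) * Gc (Function.update (Function.update p f 0) e 0) ends o a₂ a₁ a₃ b *
                    prob (Function.update p e 0) (PDEvent ends a₂ a₁ a₃)) +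
              SClosure p ends o a₂ a₁ a₃ b e f) +
          p e ^ 2 *
            (prob (Function.update p e 0) (avoidAll ends a₁ {a₂}) * prob (Function.update p e 1) (avoidAll ends a₁ {a₂}) *
              prob (Function.update (Function.update p f 0) e 0) (avoidAll ends a₁ {a₂}) *
              prob (Function.update (Function.update p f 0) e 1) (avoidAll ends a₁ {a₂})) *
            (prob (Function.update p e 0) (PDEvent ends a₂ a₁ a₃) *
              prob (Function.update (Function.update p f 0) e 0) (PDEvent ends a₂ a₁ a₃)) *
            (g1C p ends o a₂ a₁ b e - (1 - p f) * g1C (Function.update p f 0) ends o a₂ a₁ b e)) := by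
      have hM' := hM.le
      refine mul_nonneg (sq_nonneg _) (add_nonneg (add_nonneg ?_ ?_) ?_)
      · exact mul_nonneg (mul_nonneg (sq_nonneg _) hM') hΔ₀
      · exact mul_nonneg (mul_nonneg ht0 h1t) hβ
      · exact mul_nonneg (mul_nonneg (mul_nonneg (sq_nonneg _) hM') (mul_nonneg hD0 hD0f))
          (sub_nonneg.2 hg)
    rw [← hid] at hbr
    have hX := (mul_nonneg_iff_of_pos_left hM).1 hbr
    linarith
  · exact dChord_of_update_zero_of_degenerate p ends b hp hends hef hG1 hG1' hM.symm h0

end Degenerate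

end Mix

end Summit.Ventures.PercRepro2
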